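import Literature.Analysis.SegalBargmann.SchrodingerSchwartzBridge
import Literature.Analysis.SegalBargmann.SchwartzFourierUnitary
import HarnessLib

/-!
# The modulation group of the Schrödinger representation is differentiable in the Schwartz topology;
# a continuous operator commuting with the Heisenberg operators commutes with `x_j` and `∂_j`

Source followed for the objects: G. B. Folland, *Harmonic Analysis in Phase Space* (1989) §1.3 (1.25)
`ρ(p,q,t) = e^{2πi(pD + qX + tI)}`, `ρ(p,q) f(x) = e^{2πi q·x + πi p·q} f(x + p)` (tree `rhoS`, file
`SchrodingerSchwartzBridge`), whose one-parameter groups `t ↦ ρ(0, tq) = e^{2πit q·X}` have the multipliers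
`2πi q·x` as generators, and "the operators `ρ(p,q,t)` … are continuous on `𝓢`" (loc. cit.).
Everything below is PROVED (Mathlib + tree); no statement of print is asserted or used as a hypothesis.

## Main results (`SR σ = 𝓢(ℝ^σ, ℂ)` on the sup-norm carrier `σ → ℝ`, every finite `σ`)

* §1 `modProfile t u = t⁻¹ (e^{2πitu} − 1) − 2πiu`, its iterated derivatives and the uniform bound
  `‖(modProfile t)^{(k)}(u)‖ ≤ |t| (2π)^{k+2} (1+|u|)²` for `0 < |t| ≤ 1` (`norm_iteratedDeriv_modProfile_le`).
* §2 `mulDot q := smulLeftCLM ℂ (x ↦ x⬝q)` and the seminorm estimate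
  `p_{k,n}(t⁻¹(ρ(0,tq)f − f) − 2πi·mulDot q f) ≤ |t| · C(k,n,q,f)` (`seminorm_modQuot_le`), whence
  **`tendsto_modQuot`**: `t⁻¹ • (ρ(0,tq) f − f) → (2πi) • mulDot q f` in the SCHWARTZ TOPOLOGY as `t → 0`.
* §3 **`comm_mulDot_of_comm_rhoS`**: a continuous linear `T : 𝓢 → 𝓢` with `T ρ(0,q) = ρ(0,q) T` for all
  `q` satisfies `T (mulDot q f) = mulDot q (T f)`; in particular it commutes with every coordinate multiplier.
* §4 **`lineDerivOp_fourierPi`**: `∂_{v} (𝓕 f) = −2πi • 𝓕 (mulDot v f)` for the tree Fourier transform `fourierPi`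
  on the Folland carrier (transport of Mathlib's `SchwartzMap.lineDerivOp_fourier_eq` along `schwartzTransport
  (euclE σ)`), and **`comm_lineDerivOp_of_comm_rhoS`**: a continuous linear `T` commuting with every `ρ(p,q)`
  commutes with every directional derivative `∂_{v}` (apply §3 to the Fourier conjugate `𝓕³ T 𝓕`, which again
  commutes with all `ρ(p,q)` by `fourierPi_rhoS` and `𝓕⁴ = 1`).

These are the two inputs (`x_j`- and `∂_j`-commutation) of the Schwartz-space Schur lemma for `ρ` (pub-hodgecm node
W2-∞, J-W2glob-7 (iv)); the Hermite-ladder half lives in `HermiteLadderRigidity`.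

## References

* [Folland1989] G. B. Folland, *Harmonic Analysis in Phase Space*, Annals of Mathematics Studies 122, Princeton
  University Press, 1989, §1.3 (1.23)–(1.25), Prop. (1.43); §4.2 (4.23) (doi:10.1515/9781400882427).
-/

noncomputable section

open MeasureTheory Complex Real Filter Topology
open scoped ComplexConjugate

namespace Literature.Analysis.SegalBargmann

/-- Folland's Schwartz space `𝓢(ℝ^σ)` on the sup-norm carrier. -/
local notation "SR" σ:max => (SchwartzMap (σ → ℝ) ℂ)

variable {σ : Type*} [Fintype σ] [DecidableEq σ]

/-! ## 1. The one-variable profile `φ_t(u) = t⁻¹ (e^{2πitu} − 1) − 2πiu` -/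

section Profile

/-- The frequency `κ t = 2πit`. [folklore] -/
def modFreq (t : ℝ) : ℂ := 2 * π * t * I

/-- `‖κ t‖ = 2π|t|`. [folklore] -/
theorem norm_modFreq (t : ℝ) : ‖modFreq t‖ = 2 * π * |t| := by
  rw [modFreq, show (2 * π * t * I : ℂ) = ((2 * π * t : ℝ) : ℂ) * I by push_cast; ring, norm_mul,
    Complex.norm_I, mul_one, Complex.norm_real, Real.norm_eq_abs, abs_mul, abs_of_pos two_pi_pos]

/-- `κ 1 = 2πi ≠ 0`. [folklore] -/
theorem modFreq_one_ne_zero : modFreq 1 ≠ 0 := by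
  rw [← norm_pos_iff, norm_modFreq, abs_one, mul_one]; exact two_pi_pos

/-- For `t ≠ 0`, `t⁻¹ κ t = κ 1`. [folklore] -/
theorem inv_mul_modFreq {t : ℝ} (ht : t ≠ 0) : (t : ℂ)⁻¹ * modFreq t = modFreq 1 := by
  have ht' : (t : ℂ) ≠ 0 := Complex.ofReal_ne_zero.2 ht
  rw [modFreq, modFreq]; push_cast; field_simp

/-- The profile `φ_t(u) = t⁻¹ (e^{κ_t u} − 1) − κ_1 u`. [folklore] -/
def modProfile (t u : ℝ) : ℂ := (t : ℂ)⁻¹ * (cexp (modFreq t * u) - 1) - modFreq 1 * u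

/-- `φ_t(0) = 0`. [folklore] -/
theorem modProfile_zero (t : ℝ) : modProfile t 0 = 0 := by
  simp [modProfile]

/-- `d/du (a e^{κ u}) = a κ e^{κ u}`. [folklore] -/
theorem hasDerivAt_const_mul_cexp (a κ : ℂ) (u : ℝ) :
    HasDerivAt (fun u : ℝ => a * cexp (κ * u)) (a * κ * cexp (κ * u)) u := by
  have h1 : HasDerivAt (fun u : ℝ => κ * (u : ℂ)) (κ * 1) u := (hasDerivAt_id u).ofReal_comp.const_mul κ
  exact (h1.cexp.const_mul a).congr_deriv (by ring)

/-- `φ_t` is differentiable with `φ_t'(u) = κ_1 (e^{κ_t u} − 1)` (`t ≠ 0`). [folklore] -/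
theorem hasDerivAt_modProfile {t : ℝ} (ht : t ≠ 0) (u : ℝ) :
    HasDerivAt (modProfile t) (modFreq 1 * (cexp (modFreq t * u) - 1)) u := by
  have h1 : HasDerivAt (fun u : ℝ => (t : ℂ)⁻¹ * cexp (modFreq t * u))
      ((t : ℂ)⁻¹ * modFreq t * cexp (modFreq t * u)) u := hasDerivAt_const_mul_cexp _ _ u
  have h2 : HasDerivAt (fun u : ℝ => modFreq 1 * (u : ℂ)) (modFreq 1 * 1) u :=
    (hasDerivAt_id u).ofReal_comp.const_mul _
  have h3 : HasDerivAt (fun u : ℝ => (t : ℂ)⁻¹ * cexp (modFreq t * u) - (t : ℂ)⁻¹ - modFreq 1 * (u : ℂ))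
      ((t : ℂ)⁻¹ * modFreq t * cexp (modFreq t * u) - modFreq 1 * 1) u := (h1.sub_const ((t : ℂ)⁻¹)).sub h2
  have h4 : modProfile t = fun u : ℝ => (t : ℂ)⁻¹ * cexp (modFreq t * u) - (t : ℂ)⁻¹ - modFreq 1 * (u : ℂ) := by
    funext u; simp only [modProfile]; ring
  rw [h4]
  refine h3.congr_deriv ?_
  rw [← inv_mul_modFreq ht]; ring

/-- `φ_t` is smooth. [folklore] -/
theorem contDiff_modProfile (t : ℝ) {n : WithTop ℕ∞} : ContDiff ℝ n (modProfile t) := by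
  have h1 : ContDiff ℝ n fun u : ℝ => (u : ℂ) := ofRealCLM.contDiff
  unfold modProfile
  exact (contDiff_const.mul (((contDiff_const.mul h1).cexp).sub contDiff_const)).sub (contDiff_const.mul h1)

/-- `φ_t^{(1)} = κ_1 (e^{κ_t u} − 1)`. [folklore] -/
theorem iteratedDeriv_one_modProfile {t : ℝ} (ht : t ≠ 0) :
    iteratedDeriv 1 (modProfile t) = fun u : ℝ => modFreq 1 * (cexp (modFreq t * u) - 1) := by
  rw [iteratedDeriv_one]; funext u; exact (hasDerivAt_modProfile ht u).deriv

/-- `φ_t^{(k+2)} = κ_1 κ_t^{k+1} e^{κ_t u}`. [folklore] -/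
theorem iteratedDeriv_add_two_modProfile {t : ℝ} (ht : t ≠ 0) (k : ℕ) :
    iteratedDeriv (k + 2) (modProfile t) =
      fun u : ℝ => modFreq 1 * modFreq t ^ (k + 1) * cexp (modFreq t * u) := by
  induction k with
  | zero =>
    rw [zero_add, iteratedDeriv_succ, iteratedDeriv_one_modProfile ht]
    funext u
    have h1 : HasDerivAt (fun u : ℝ => modFreq 1 * (cexp (modFreq t * u) - 1))
        (modFreq 1 * modFreq t * cexp (modFreq t * u)) u := by
      have h := (hasDerivAt_const_mul_cexp (modFreq 1) (modFreq t) u).sub_const (modFreq 1)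
      have h' : (fun u : ℝ => modFreq 1 * cexp (modFreq t * u) - modFreq 1) =
          fun u : ℝ => modFreq 1 * (cexp (modFreq t * u) - 1) := by
        funext v; ring
      rw [h'] at h
      exact h
    rw [h1.deriv]; ring
  | succ k ih =>
    rw [show k + 1 + 2 = (k + 2) + 1 by ring, iteratedDeriv_succ, ih]
    funext u
    rw [(hasDerivAt_const_mul_cexp _ _ u).deriv]; ring

/-- `|e^{κ_t u} − 1| ≤ 2π|t||u|`. [folklore] -/
theorem norm_cexp_modFreq_sub_one_le (t u : ℝ) : ‖cexp (modFreq t * u) - 1‖ ≤ 2 * π * |t| * |u| := by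
  have h1 : modFreq t * (u : ℂ) = I * ((2 * π * t * u : ℝ) : ℂ) := by rw [modFreq]; push_cast; ring
  rw [h1]
  refine (Real.norm_exp_I_mul_ofReal_sub_one_le).trans (le_of_eq ?_)
  rw [Real.norm_eq_abs, abs_mul, abs_mul, abs_mul, abs_of_pos two_pos, abs_of_pos pi_pos]

/-- `|φ_t'(u)| ≤ 4π²|t||u|`. [folklore] -/
theorem norm_deriv_modProfile_le {t : ℝ} (ht : t ≠ 0) (u : ℝ) :
    ‖deriv (modProfile t) u‖ ≤ 4 * π ^ 2 * |t| * |u| := by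
  rw [(hasDerivAt_modProfile ht u).deriv, norm_mul, norm_modFreq, abs_one, mul_one]
  calc 2 * π * ‖cexp (modFreq t * u) - 1‖ ≤ 2 * π * (2 * π * |t| * |u|) :=
        mul_le_mul_of_nonneg_left (norm_cexp_modFreq_sub_one_le t u) two_pi_pos.le
    _ = 4 * π ^ 2 * |t| * |u| := by ring

/-- `|φ_t(u)| ≤ 4π²|t| u²` (mean value theorem from `φ_t(0) = 0`). [folklore] -/
theorem norm_modProfile_le {t : ℝ} (ht : t ≠ 0) (u : ℝ) : ‖modProfile t u‖ ≤ 4 * π ^ 2 * |t| * |u| * |u| := by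
  have h := Convex.norm_image_sub_le_of_norm_deriv_le (f := modProfile t) (s := Set.uIcc 0 u)
    (C := 4 * π ^ 2 * |t| * |u|) (fun x _ => (hasDerivAt_modProfile ht x).differentiableAt)
    (fun x hx => by
      refine (norm_deriv_modProfile_le ht x).trans (mul_le_mul_of_nonneg_left ?_ (by positivity))
      rcases Set.mem_uIcc.1 hx with ⟨h1, h2⟩ | ⟨h1, h2⟩
      · rw [abs_of_nonneg h1]; exact h2.trans (le_abs_self u)
      · rw [abs_of_nonpos h2, abs_of_nonpos (h1.trans h2)]; exact neg_le_neg h1)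
    (convex_uIcc 0 u) Set.left_mem_uIcc Set.right_mem_uIcc
  rwa [modProfile_zero, sub_zero, sub_zero, Real.norm_eq_abs] at h

/-- **Uniform bound on all derivatives of the profile**: for `0 < |t| ≤ 1`,
`‖φ_t^{(k)}(u)‖ ≤ |t| (2π)^{k+2} (1+|u|)²`. [folklore] -/
theorem norm_iteratedDeriv_modProfile_le {t : ℝ} (ht : t ≠ 0) (ht1 : |t| ≤ 1) (k : ℕ) (u : ℝ) :
    ‖iteratedDeriv k (modProfile t) u‖ ≤ |t| * (2 * π) ^ (k + 2) * (1 + |u|) ^ 2 := by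
  have hπ : 1 ≤ 2 * π := by linarith [pi_gt_three]
  have hu1 : |u| ≤ (1 + |u|) ^ 2 := by nlinarith [abs_nonneg u]
  have hu2 : |u| * |u| ≤ (1 + |u|) ^ 2 := by nlinarith [abs_nonneg u]
  have hu3 : 1 ≤ (1 + |u|) ^ 2 := by nlinarith [abs_nonneg u]
  rcases k with _ | _ | k
  · rw [iteratedDeriv_zero]
    calc ‖modProfile t u‖ ≤ 4 * π ^ 2 * |t| * |u| * |u| := norm_modProfile_le ht u
      _ = |t| * (2 * π) ^ (0 + 2) * (|u| * |u|) := by ring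
      _ ≤ |t| * (2 * π) ^ (0 + 2) * (1 + |u|) ^ 2 := mul_le_mul_of_nonneg_left hu2 (by positivity)
  · rw [iteratedDeriv_one]
    calc ‖deriv (modProfile t) u‖ ≤ 4 * π ^ 2 * |t| * |u| := norm_deriv_modProfile_le ht u
      _ = |t| * (2 * π) ^ 2 * 1 * |u| := by ring
      _ ≤ |t| * (2 * π) ^ 2 * (2 * π) * (1 + |u|) ^ 2 := by gcongr
      _ = |t| * (2 * π) ^ (1 + 2) * (1 + |u|) ^ 2 := by ring
  · rw [iteratedDeriv_add_two_modProfile ht k]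
    dsimp only
    rw [norm_mul, norm_mul, norm_pow, norm_modFreq, norm_modFreq, abs_one, mul_one, Complex.norm_exp,
      show (modFreq t * (u : ℂ)).re = 0 by rw [modFreq]; simp, Real.exp_zero, mul_one]
    have h1 : (2 * π * |t|) ^ (k + 1) ≤ (2 * π) ^ (k + 1) * |t| := by
      rw [mul_pow]
      refine mul_le_mul_of_nonneg_left ?_ (by positivity)
      calc |t| ^ (k + 1) ≤ |t| ^ 1 := pow_le_pow_of_le_one (abs_nonneg t) ht1 (by omega)
        _ = |t| := pow_one _
    calc 2 * π * (2 * π * |t|) ^ (k + 1) ≤ 2 * π * ((2 * π) ^ (k + 1) * |t|) :=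
          mul_le_mul_of_nonneg_left h1 (by positivity)
      _ = |t| * (2 * π) ^ (k + 2) * 1 := by ring
      _ ≤ |t| * (2 * π) ^ (k + 2) * (2 * π) ^ 2 := by gcongr; nlinarith
      _ = |t| * (2 * π) ^ (k + 2 + 2) * 1 := by ring
      _ ≤ |t| * (2 * π) ^ (k + 2 + 2) * (1 + |u|) ^ 2 := by gcongr

end Profile

/-! ## 2. The difference quotient of the modulation group in the Schwartz topology -/

section Modulation

/-- The linear functional `x ↦ x ⬝ᵥ q` as a continuous linear map. [folklore] -/
def dotCLM (q : σ → ℝ) : (σ → ℝ) →L[ℝ] ℝ :=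
  LinearMap.toContinuousLinearMap
    { toFun := fun x => x ⬝ᵥ q
      map_add' := fun x y => add_dotProduct x y q
      map_smul' := fun c x => by simp only [smul_dotProduct, smul_eq_mul, RingHom.id_apply] }

omit [DecidableEq σ] in
/-- `dotCLM q x = x ⬝ᵥ q`. [folklore] -/
@[simp] theorem dotCLM_apply (q x : σ → ℝ) : dotCLM q x = x ⬝ᵥ q := rfl

omit [DecidableEq σ] in
/-- `x ↦ (x ⬝ᵥ q : ℂ)` has temperate growth. [folklore] -/
theorem hasTemperateGrowth_dot (q : σ → ℝ) : (fun x : σ → ℝ => ((x ⬝ᵥ q : ℝ) : ℂ)).HasTemperateGrowth := by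
  have h : (fun x : σ → ℝ => ((x ⬝ᵥ q : ℝ) : ℂ)) = ⇑Complex.ofRealCLM ∘ ⇑(dotCLM q) := by
    funext x; simp [dotCLM_apply]
  rw [h]
  exact Complex.ofRealCLM.hasTemperateGrowth.comp (dotCLM q).hasTemperateGrowth

/-- **The multiplier `x ↦ x ⬝ᵥ q` on Schwartz space** (the infinitesimal generator of `t ↦ ρ(0,tq)` up to
`2πi`). [cite: Folland1989, §1.3 (1.25)] -/
def mulDot (q : σ → ℝ) : (SR σ) →L[ℂ] SR σ :=
  SchwartzMap.smulLeftCLM ℂ (fun x : σ → ℝ => ((x ⬝ᵥ q : ℝ) : ℂ))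

omit [DecidableEq σ] in
/-- `mulDot q f x = (x ⬝ᵥ q) f x`. [folklore] -/
@[simp] theorem mulDot_apply (q : σ → ℝ) (f : SR σ) (x : σ → ℝ) : mulDot q f x = (x ⬝ᵥ q : ℝ) * f x := by
  rw [mulDot, SchwartzMap.smulLeftCLM_apply_apply (hasTemperateGrowth_dot q), smul_eq_mul]

omit [DecidableEq σ] in
/-- The modulation multiplier at frequency `tq` is `e^{κ_t (x⬝q)}`. [folklore] -/
theorem rhoMul_zero_smul (t : ℝ) (q x : σ → ℝ) : rhoMul 0 (t • q) x = cexp (modFreq t * ((x ⬝ᵥ q : ℝ) : ℂ)) := by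
  rw [rhoMul, modFreq]
  congr 1
  have h1 : ∑ k, (t • q) k * x k = t * (x ⬝ᵥ q) := by
    rw [dotProduct, Finset.mul_sum]
    exact Finset.sum_congr rfl fun k _ => by rw [Pi.smul_apply, smul_eq_mul]; ring
  simp only [Pi.zero_apply, zero_mul, Finset.sum_const_zero, mul_zero, add_zero, h1]
  push_cast; ring

/-- The multiplier of the difference quotient: `m_t(x) = t⁻¹ (ρ-multiplier − 1) − κ_1 (x⬝q)`. [folklore] -/
def modQuotMul (t : ℝ) (q : σ → ℝ) (x : σ → ℝ) : ℂ :=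
  (t : ℂ)⁻¹ * (rhoMul 0 (t • q) x - 1) - modFreq 1 * ((x ⬝ᵥ q : ℝ) : ℂ)

omit [DecidableEq σ] in
/-- `m_t = φ_t ∘ (· ⬝ᵥ q)`. [folklore] -/
theorem modQuotMul_eq (t : ℝ) (q : σ → ℝ) : modQuotMul t q = modProfile t ∘ ⇑(dotCLM q) := by
  funext x
  rw [Function.comp_apply, dotCLM_apply, modQuotMul, modProfile, rhoMul_zero_smul]

omit [DecidableEq σ] in
/-- `m_t` has temperate growth. [folklore] -/
theorem hasTemperateGrowth_modQuotMul (t : ℝ) (q : σ → ℝ) : (modQuotMul t q).HasTemperateGrowth :=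
  ((Function.HasTemperateGrowth.const _).mul ((hasTemperateGrowth_rhoMul 0 (t • q)).sub
    (Function.HasTemperateGrowth.const _))).sub ((Function.HasTemperateGrowth.const _).mul (hasTemperateGrowth_dot q))

/-- The difference quotient minus its limit: `Q_t f = t⁻¹ (ρ(0,tq) f − f) − κ_1 • mulDot q f`. [folklore] -/
def modQuot (t : ℝ) (q : σ → ℝ) (f : SR σ) : SR σ :=
  (t : ℂ)⁻¹ • (rhoS 0 (t • q) f - f) - modFreq 1 • mulDot q f

omit [DecidableEq σ] in
/-- `Q_t f` is multiplication by `m_t`. [folklore] -/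
theorem modQuot_apply (t : ℝ) (q : σ → ℝ) (f : SR σ) (x : σ → ℝ) : modQuot t q f x = modQuotMul t q x * f x := by
  simp only [modQuot, sub_apply, smul_apply, rhoS_apply, add_zero, mulDot_apply, smul_eq_mul,
    modQuotMul]
  ring

omit [DecidableEq σ] in
/-- `Q_t f = smulLeftCLM m_t f`. [folklore] -/
theorem modQuot_eq_smulLeftCLM (t : ℝ) (q : σ → ℝ) (f : SR σ) :
    modQuot t q f = SchwartzMap.smulLeftCLM ℂ (modQuotMul t q) f := by
  ext x
  rw [modQuot_apply, SchwartzMap.smulLeftCLM_apply_apply (hasTemperateGrowth_modQuotMul t q), smul_eq_mul]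

omit [DecidableEq σ] in
/-- Bound on the derivatives of the multiplier: `‖Dⁱ m_t (x)‖ ≤ |t| (2π)^{i+2} ‖ℓ_q‖ⁱ (1 + ‖ℓ_q‖‖x‖)²`
for `0 < |t| ≤ 1`. [folklore] -/
theorem norm_iteratedFDeriv_modQuotMul_le {t : ℝ} (ht : t ≠ 0) (ht1 : |t| ≤ 1) (q : σ → ℝ) (i : ℕ)
    (x : σ → ℝ) :
    ‖iteratedFDeriv ℝ i (modQuotMul t q) x‖ ≤
      |t| * (2 * π) ^ (i + 2) * ‖dotCLM q‖ ^ i * (1 + ‖dotCLM q‖ * ‖x‖) ^ 2 := by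
  rw [modQuotMul_eq, (dotCLM q).iteratedFDeriv_comp_right (contDiff_modProfile t (n := i)) x le_rfl]
  refine (ContinuousMultilinearMap.norm_compContinuousLinearMap_le _ _).trans ?_
  rw [Finset.prod_const, Finset.card_univ, Fintype.card_fin, norm_iteratedFDeriv_eq_norm_iteratedDeriv]
  have h1 := norm_iteratedDeriv_modProfile_le ht ht1 i (dotCLM q x)
  have h2 : |dotCLM q x| ≤ ‖dotCLM q‖ * ‖x‖ := by
    rw [← Real.norm_eq_abs]; exact (dotCLM q).le_opNorm x
  have h3 : (1 + |dotCLM q x|) ^ 2 ≤ (1 + ‖dotCLM q‖ * ‖x‖) ^ 2 := by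
    gcongr
  calc ‖iteratedDeriv i (modProfile t) (dotCLM q x)‖ * ‖dotCLM q‖ ^ i
      ≤ |t| * (2 * π) ^ (i + 2) * (1 + |dotCLM q x|) ^ 2 * ‖dotCLM q‖ ^ i :=
        mul_le_mul_of_nonneg_right h1 (by positivity)
    _ ≤ |t| * (2 * π) ^ (i + 2) * (1 + ‖dotCLM q‖ * ‖x‖) ^ 2 * ‖dotCLM q‖ ^ i := by gcongr
    _ = |t| * (2 * π) ^ (i + 2) * ‖dotCLM q‖ ^ i * (1 + ‖dotCLM q‖ * ‖x‖) ^ 2 := by ring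

omit [DecidableEq σ] in
/-- The `t`-free constant of the seminorm estimate. [folklore] -/
def modQuotConst (k n : ℕ) (q : σ → ℝ) (f : SR σ) : ℝ :=
  ∑ i ∈ Finset.range (n + 1), (n.choose i : ℝ) * ((2 * π) ^ (i + 2) * ‖dotCLM q‖ ^ i) *
    (2 * (SchwartzMap.seminorm ℂ k (n - i) f + ‖dotCLM q‖ ^ 2 * SchwartzMap.seminorm ℂ (k + 2) (n - i) f))

omit [DecidableEq σ] in
/-- `0 ≤ C(k,n,q,f)`. [folklore] -/
theorem modQuotConst_nonneg (k n : ℕ) (q : σ → ℝ) (f : SR σ) : 0 ≤ modQuotConst k n q f :=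
  Finset.sum_nonneg fun i _ => by positivity

omit [DecidableEq σ] in
/-- The weight absorption `‖x‖^k (1 + c‖x‖)² A ≤ 2 (p_{k} + c² p_{k+2})` at a point. [folklore] -/
theorem pow_mul_sq_mul_le (k m : ℕ) (c : ℝ) (f : SR σ) (x : σ → ℝ) :
    ‖x‖ ^ k * (1 + c * ‖x‖) ^ 2 * ‖iteratedFDeriv ℝ m f x‖ ≤
      2 * (SchwartzMap.seminorm ℂ k m f + c ^ 2 * SchwartzMap.seminorm ℂ (k + 2) m f) := by
  have h1 := SchwartzMap.le_seminorm ℂ k m f x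
  have h2 := SchwartzMap.le_seminorm ℂ (k + 2) m f x
  have h3 : (1 + c * ‖x‖) ^ 2 ≤ 2 * (1 + c ^ 2 * ‖x‖ ^ 2) := by nlinarith [sq_nonneg (1 - c * ‖x‖)]
  have hA : 0 ≤ ‖iteratedFDeriv ℝ m f x‖ := norm_nonneg _
  calc ‖x‖ ^ k * (1 + c * ‖x‖) ^ 2 * ‖iteratedFDeriv ℝ m f x‖
      ≤ ‖x‖ ^ k * (2 * (1 + c ^ 2 * ‖x‖ ^ 2)) * ‖iteratedFDeriv ℝ m f x‖ := by gcongr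
    _ = 2 * (‖x‖ ^ k * ‖iteratedFDeriv ℝ m f x‖ + c ^ 2 * (‖x‖ ^ (k + 2) * ‖iteratedFDeriv ℝ m f x‖)) := by
        ring
    _ ≤ 2 * (SchwartzMap.seminorm ℂ k m f + c ^ 2 * SchwartzMap.seminorm ℂ (k + 2) m f) := by gcongr

omit [DecidableEq σ] in
/-- **Seminorm estimate**: `p_{k,n}(Q_t f) ≤ |t| · C(k,n,q,f)` for `0 < |t| ≤ 1`. [folklore] -/
theorem seminorm_modQuot_le {t : ℝ} (ht : t ≠ 0) (ht1 : |t| ≤ 1) (q : σ → ℝ) (f : SR σ) (k n : ℕ) :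
    SchwartzMap.seminorm ℂ k n (modQuot t q f) ≤ |t| * modQuotConst k n q f := by
  refine SchwartzMap.seminorm_le_bound ℂ k n _ (mul_nonneg (abs_nonneg t) (modQuotConst_nonneg k n q f)) ?_
  intro x
  have hfun : ⇑(modQuot t q f) = fun y => modQuotMul t q y * f y := funext (modQuot_apply t q f)
  rw [hfun]
  have hm : ContDiff ℝ n (modQuotMul t q) := by
    rw [modQuotMul_eq]; exact (contDiff_modProfile t).comp (dotCLM q).contDiff
  have hL := norm_iteratedFDeriv_mul_le (𝕜 := ℝ) hm (f.smooth n) x (n := n) le_rfl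
  refine (mul_le_mul_of_nonneg_left hL (by positivity)).trans ?_
  rw [Finset.mul_sum, modQuotConst, Finset.mul_sum]
  refine Finset.sum_le_sum fun i _ => ?_
  have hb := norm_iteratedFDeriv_modQuotMul_le ht ht1 q i x
  have hw := pow_mul_sq_mul_le k (n - i) ‖dotCLM q‖ f x
  calc ‖x‖ ^ k * ((n.choose i : ℝ) * ‖iteratedFDeriv ℝ i (modQuotMul t q) x‖ * ‖iteratedFDeriv ℝ (n - i) f x‖)
      ≤ ‖x‖ ^ k * ((n.choose i : ℝ) * (|t| * (2 * π) ^ (i + 2) * ‖dotCLM q‖ ^ i * (1 + ‖dotCLM q‖ * ‖x‖) ^ 2) *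
          ‖iteratedFDeriv ℝ (n - i) f x‖) := by gcongr
    _ = |t| * ((n.choose i : ℝ) * ((2 * π) ^ (i + 2) * ‖dotCLM q‖ ^ i) *
          (‖x‖ ^ k * (1 + ‖dotCLM q‖ * ‖x‖) ^ 2 * ‖iteratedFDeriv ℝ (n - i) f x‖)) := by ring
    _ ≤ |t| * ((n.choose i : ℝ) * ((2 * π) ^ (i + 2) * ‖dotCLM q‖ ^ i) *
          (2 * (SchwartzMap.seminorm ℂ k (n - i) f + ‖dotCLM q‖ ^ 2 * SchwartzMap.seminorm ℂ (k + 2) (n - i) f))) := by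
        gcongr

omit [DecidableEq σ] in
/-- **The modulation group is differentiable at `t = 0` in the Schwartz topology**:
`t⁻¹ • (ρ(0,tq) f − f) → 2πi • (x⬝q) f` as `t → 0`, `t ≠ 0` (cf. Folland1989 §1.3 (1.25):
`ρ(0,q,0) = e^{2πi qX}`). [folklore] -/
theorem tendsto_modQuot (q : σ → ℝ) (f : SR σ) :
    Tendsto (fun t : ℝ => (t : ℂ)⁻¹ • (rhoS 0 (t • q) f - f)) (𝓝[≠] 0) (𝓝 (modFreq 1 • mulDot q f)) := by
  rw [(schwartz_withSeminorms ℂ (σ → ℝ) ℂ).tendsto_nhds]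
  rintro ⟨k, n⟩ ε hε
  have hC := modQuotConst_nonneg k n q f
  set δ : ℝ := min 1 (ε / (modQuotConst k n q f + 1)) with hδ
  have hδpos : 0 < δ := lt_min one_pos (div_pos hε (by linarith))
  filter_upwards [self_mem_nhdsWithin, mem_nhdsWithin_of_mem_nhds (Metric.ball_mem_nhds (0 : ℝ) hδpos)]
    with t ht hball
  rw [Metric.mem_ball, dist_zero_right, Real.norm_eq_abs] at hball
  have ht1 : |t| ≤ 1 := (hball.trans_le (min_le_left _ _)).le
  have h1 := seminorm_modQuot_le (ht : t ≠ 0) ht1 q f k n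
  rw [SchwartzMap.schwartzSeminormFamily_apply]
  change SchwartzMap.seminorm ℂ k n (modQuot t q f) < ε
  refine h1.trans_lt ?_
  have h2 : |t| < ε / (modQuotConst k n q f + 1) := hball.trans_le (min_le_right _ _)
  calc |t| * modQuotConst k n q f ≤ |t| * (modQuotConst k n q f + 1) := by gcongr; linarith
    _ < ε / (modQuotConst k n q f + 1) * (modQuotConst k n q f + 1) := by gcongr
    _ = ε := div_mul_cancel₀ ε (by linarith)

end Modulation

/-! ## 3. A continuous operator commuting with the modulations commutes with the multipliers `x⬝q` -/

section Commute

omit [DecidableEq σ] in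
/-- **If a continuous linear `T : 𝓢 → 𝓢` commutes with every modulation `ρ(0,q)` then it commutes with every
multiplier `x ↦ x⬝q`** (differentiate `t ↦ T ρ(0,tq) = ρ(0,tq) T` at `t = 0` in the Schwartz topology).
[folklore] -/
theorem comm_mulDot_of_comm_modulation (T : (SR σ) →L[ℂ] SR σ)
    (hT : ∀ (q : σ → ℝ) (f : SR σ), T (rhoS 0 q f) = rhoS 0 q (T f)) (q : σ → ℝ) (f : SR σ) :
    T (mulDot q f) = mulDot q (T f) := by
  have h1 : Tendsto (fun t : ℝ => T ((t : ℂ)⁻¹ • (rhoS 0 (t • q) f - f))) (𝓝[≠] 0)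
      (𝓝 (T (modFreq 1 • mulDot q f))) :=
    (T.continuous.tendsto _).comp (tendsto_modQuot q f)
  have h2 : (fun t : ℝ => T ((t : ℂ)⁻¹ • (rhoS 0 (t • q) f - f))) =
      fun t : ℝ => (t : ℂ)⁻¹ • (rhoS 0 (t • q) (T f) - T f) := by
    funext t; rw [map_smul, map_sub, hT]
  rw [h2] at h1
  have h3 := tendsto_nhds_unique h1 (tendsto_modQuot q (T f))
  rw [map_smul] at h3
  exact smul_right_injective (SR σ) modFreq_one_ne_zero h3

omit [DecidableEq σ] in
/-- The same for an operator commuting with all the Heisenberg operators `ρ(p,q)`. [folklore] -/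
theorem comm_mulDot_of_comm_rhoS (T : (SR σ) →L[ℂ] SR σ)
    (hT : ∀ (p q : σ → ℝ) (f : SR σ), T (rhoS p q f) = rhoS p q (T f)) (q : σ → ℝ) (f : SR σ) :
    T (mulDot q f) = mulDot q (T f) :=
  comm_mulDot_of_comm_modulation T (fun q f => hT 0 q f) q f

end Commute

/-! ## 4. … and with the directional derivatives (Fourier conjugation) -/

section Fourier

open LineDeriv
open scoped FourierTransform InnerProductSpace

/-- `κ 1 = 2πi`. [folklore] -/
theorem modFreq_one : modFreq 1 = 2 * π * I := by
  rw [modFreq]; push_cast; ring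

omit [DecidableEq σ] in
/-- The Euclidean inner product against `e⁻¹ v` is the dot product on the Folland carrier. [folklore] -/
theorem inner_euclE_symm (y : EuclideanSpace ℝ σ) (v : σ → ℝ) :
    inner ℝ y ((euclE σ).symm v) = (euclE σ y) ⬝ᵥ v := by
  rw [EuclideanSpace.inner_eq_star_dotProduct, star_trivial, dotProduct_comm]; rfl

omit [DecidableEq σ] in
/-- The multiplier `⟪·, e⁻¹ v⟫` on `𝓢(EuclideanSpace ℝ σ)` is the transport of `mulDot v`. [folklore] -/
theorem smulLeftCLM_inner_transport (v : σ → ℝ) (f : SR σ) :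
    SchwartzMap.smulLeftCLM ℂ (inner ℝ · ((euclE σ).symm v)) ((schwartzTransport (euclE σ)).symm f) =
      (schwartzTransport (euclE σ)).symm (mulDot v f) := by
  ext y
  rw [SchwartzMap.smulLeftCLM_apply_apply (by fun_prop), schwartzTransport_symm_apply,
    schwartzTransport_symm_apply, mulDot_apply, inner_euclE_symm, Complex.real_smul]

omit [DecidableEq σ] in
/-- Directional derivatives commute with the carrier transport: `∂_v (e^* h) = e^* (∂_{e⁻¹ v} h)`. [folklore] -/
theorem lineDerivOp_schwartzTransport (v : σ → ℝ) (h : SchwartzMap (EuclideanSpace ℝ σ) ℂ) :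
    ∂_{v} (schwartzTransport (euclE σ) h) = schwartzTransport (euclE σ) (∂_{(euclE σ).symm v} h) :=
  SchwartzMap.lineDerivOp_compCLMOfContinuousLinearEquiv (𝕜 := ℂ) v (euclE σ).symm h

/-- **`∂_v ∘ 𝓕 = −2πi · 𝓕 ∘ M_v`** on the Folland carrier: `∂_{v} (𝓕 f) = −2πi 𝓕 ((x⬝v) f)`
(Mathlib `SchwartzMap.lineDerivOp_fourier_eq`, transported). [folklore] -/
theorem lineDerivOp_fourierPi (v : σ → ℝ) (f : SR σ) :
    ∂_{v} (fourierPi f) = -modFreq 1 • fourierPi (mulDot v f) := by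
  rw [fourierPi_apply, fourierPi_apply, lineDerivOp_schwartzTransport, SchwartzMap.lineDerivOp_fourier_eq,
    smulLeftCLM_inner_transport, ← SchwartzMap.fourierTransformCLM_apply (𝕜 := ℂ), map_smul, map_smul,
    SchwartzMap.fourierTransformCLM_apply, modFreq_one]

/-- The Fourier conjugate `T' = 𝓕³ ∘ T ∘ 𝓕` of an operator on `𝓢(ℝ^σ)`. [folklore] -/
def fourierConj (T : (SR σ) →L[ℂ] SR σ) : (SR σ) →L[ℂ] SR σ :=
  (fourierPi.comp (fourierPi.comp fourierPi)).comp (T.comp fourierPi)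

/-- `T' f = 𝓕³ (T (𝓕 f))`. [folklore] -/
theorem fourierConj_apply (T : (SR σ) →L[ℂ] SR σ) (f : SR σ) :
    fourierConj T f = fourierPi (fourierPi (fourierPi (T (fourierPi f)))) := rfl

/-- `𝓕³ ρ(p,q) = ρ(q,−p) 𝓕³`. [cite: Folland1989, §4.2, (4.23)] -/
theorem fourierPi_three_rhoS (p q : σ → ℝ) (f : SR σ) :
    fourierPi (fourierPi (fourierPi (rhoS p q f))) = rhoS q (-p) (fourierPi (fourierPi (fourierPi f))) := by
  rw [fourierPi_rhoS, fourierPi_rhoS, fourierPi_rhoS, neg_neg]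

/-- The Fourier conjugate of an operator commuting with all `ρ(p,q)` commutes with all `ρ(p,q)`. [folklore] -/
theorem fourierConj_rhoS (T : (SR σ) →L[ℂ] SR σ) (hT : ∀ (p q : σ → ℝ) (f : SR σ), T (rhoS p q f) = rhoS p q (T f))
    (p q : σ → ℝ) (f : SR σ) : fourierConj T (rhoS p q f) = rhoS p q (fourierConj T f) := by
  rw [fourierConj_apply, fourierConj_apply, fourierPi_rhoS, hT, fourierPi_three_rhoS, neg_neg]

/-- `𝓕 ∘ T' = T ∘ 𝓕`. [folklore] -/
theorem fourierPi_fourierConj (T : (SR σ) →L[ℂ] SR σ) (f : SR σ) : fourierPi (fourierConj T f) = T (fourierPi f) := by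
  rw [fourierConj_apply, fourierPi_pow_four]

/-- `T' ∘ 𝓕³ = 𝓕³ ∘ T`. [folklore] -/
theorem fourierConj_fourierPi_three (T : (SR σ) →L[ℂ] SR σ) (f : SR σ) :
    fourierConj T (fourierPi (fourierPi (fourierPi f))) = fourierPi (fourierPi (fourierPi (T f))) := by
  rw [fourierConj_apply, fourierPi_pow_four]

/-- **If a continuous linear `T : 𝓢 → 𝓢` commutes with every Heisenberg operator `ρ(p,q)` then it commutes with
every directional derivative `∂_v`** (`∂_v = −2πi 𝓕 M_v 𝓕³` and §3 applied to the Fourier conjugate `𝓕³ T 𝓕`).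
[folklore] -/
theorem comm_lineDerivOp_of_comm_rhoS (T : (SR σ) →L[ℂ] SR σ)
    (hT : ∀ (p q : σ → ℝ) (f : SR σ), T (rhoS p q f) = rhoS p q (T f)) (v : σ → ℝ) (f : SR σ) :
    T (∂_{v} f) = ∂_{v} (T f) := by
  have key : ∀ g : SR σ, ∂_{v} g = -modFreq 1 • fourierPi (mulDot v (fourierPi (fourierPi (fourierPi g)))) :=
    fun g => by
      conv_lhs => rw [← fourierPi_pow_four g]
      rw [lineDerivOp_fourierPi]
  rw [key f, key (T f), map_smul, ← fourierPi_fourierConj T (mulDot v _),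
    comm_mulDot_of_comm_rhoS (fourierConj T) (fourierConj_rhoS T hT), fourierConj_fourierPi_three]

end Fourier

end Literature.Analysis.SegalBargmann
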